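import Summits.AtomisticToContinuum.HydrodynamicLimit.Theorems.JParityClosureRateFloorNoBurstsRung0Glue

/-!
# Crux `JParityClosure.RateFloor` (stmt-AtomisticToContinuum-13080), line `Sketch`: NO BURSTS AT RUNG 0 — file 2/3, Gibbs statics

Second of three files (see `…NoBurstsRung0Glue` for the overview).  THIS FILE (registered helper stub `stub_burstsRung0Bound`):

* STATICS AT RUNG 0: every multi-pair sits in a would-be triple whose relative positions have lattice lifts in two forward swept
  tubes (`exists_sweptTube`, volume `≤ 4ε²Δ‖v − w‖`); the three-label Ruelle statics `measure_windowEvent_inter_tubeEvent_le`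
  (`posGibbs_tripleEvent_le`) bound each triple event by `256 ε⁴Δ² E‖w − v‖²`, stationarity
  (`measurePreserving_flow_localGibbsLaw_const`) moves the window starts to time `0`, and Markov's inequality gives
  `G_N{Σ_{k<K} #multiPairs(Φ_{kΔ}z) ≥ y} ≤ K(N+1)³·2048ε⁴Δ²(‖u‖²+3θ)/y` (`measure_sum_card_multiPairs_ge_le`);
* THE TWO HALVES TOGETHER: at level `y = η(N+1)/(2ε)` the static bound and a GIVEN short-flight tail add up
  (`measure_bursts_rung0_le`; the event splits on the conull good set and `Σ secondaryCount ≤` short-flight count by file 1).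

References: D. Ruelle, *Statistical Mechanics: Rigorous Results* (1969), §4.2; C. Cercignani, R. Illner, M. Pulvirenti (1994), App. 4.A.
-/

noncomputable section

open scoped BigOperators Topology ENNReal NNReal Classical
open MeasureTheory Set Filter Function
open Literature.Analysis.FluidPDE Literature.Analysis.FunctionSpaces Literature.MathematicalPhysics.KineticTheory

namespace Summit.AtomisticToContinuum.HydrodynamicLimit.Theorems

namespace RateFloorNoBursts

open RateFloorLine

/-! ### Statics at rung 0: the multi-pair count along the flow in Gibbs probability -/

/-- **The static half of the burst count at rung 0.**  For constant profiles `a, θ > 0`, `u`, small reduced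
density (`SmallDensity uniformProfile σ`, `σ ≤ 1/2`), every hard-sphere flow `Φ`, window `Δ > 0`, `K` windows
and `y > 0`: the Gibbs probability that a good orbit has `Σ_{k<K} #multiPairs(Φ_{kΔ} z) ≥ y` is at most
`K (N+1)³ · 2048 ε⁴ Δ² (‖u‖² + 3θ) / y`.  Proof: every multi-pair sits in a would-be triple
(`card_multiPairs_le_sum`); a would-be pair puts a lift of the relative position in a forward swept tube of
volume `≤ 4ε²Δ‖v − w‖` (`exists_latticeVec_mem_of_wouldBe`, `exists_sweptTube`); the three-label Gibbs
statics `measure_windowEvent_inter_tubeEvent_le` (Ruelle bound `posGibbs_tripleEvent_le`) bound each triple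
event by `256 ε⁴Δ² E‖w − v‖²`; stationarity of the Gibbs law under `Φ_{kΔ}`
(`measurePreserving_flow_localGibbsLaw_const`) and Markov's inequality conclude. [folklore] -/
theorem measure_sum_card_multiPairs_ge_le {σ : ℝ} (hσ : 0 < σ) (hσ2 : σ ≤ 1 / 2)
    (hsm : SmallDensity uniformProfile σ) {a θ : ℝ} (ha : 0 < a) (hθ : 0 < θ) (u : V3) {N : ℕ}
    (Φ : HardSphereFlow (Torus.geometry (Fin 3)) (hsDiameter σ N) (N + 1))
    {Δ : ℝ} (hΔ : 0 < Δ) (K : ℕ) {y : ℝ} (hy : 0 < y) :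
    localGibbsLaw σ (fun _ => a) (fun _ => u) (fun _ => θ) N Φ
        {z | z ∈ Φ.good ∧ y ≤ ∑ k ∈ Finset.range K,
            ((multiPairs (hsDiameter σ N) Δ (Φ.flow (k * Δ) z)).card : ℝ)} ≤
      ENNReal.ofReal ((K : ℝ) * ((N + 1 : ℕ) : ℝ) ^ 3 *
        (2048 * hsDiameter σ N ^ 4 * Δ ^ 2 * (‖u‖ ^ 2 + 3 * θ)) / y) := by
  classical
  have hε0 : 0 < hsDiameter σ N := hsDiameter_pos hσ N
  set P := localGibbsLaw σ (fun _ => a) (fun _ => u) (fun _ => θ) N Φ with hPdef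
  -- the swept tube of window `Δ` and its velocity flip
  obtain ⟨S, hSm, hSvol, hS⟩ := exists_sweptTube (h := Δ) hε0 hΔ.le
  set Sn : V3 → Set V3 := fun v => S (-v) with hSn
  have hSnm : MeasurableSet {q : V3 × V3 | q.1 ∈ Sn q.2} :=
    hSm.preimage (measurable_fst.prodMk measurable_snd.neg)
  have hSnvol : ∀ v, volume (Sn v) ≤ ENNReal.ofReal (4 * (hsDiameter σ N) ^ 2 * Δ * ‖v‖) := fun v => by
    simpa only [hSn, norm_neg] using hSvol (-v)
  have hlift : ∀ B : Set V3, MeasurableSet B →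
      volume {x : T3 | ∃ k : Fin 3 → ℤ, Torus.reprSym x + Torus.latticeVec k ∈ B} ≤ volume B :=
    fun B hB => by simpa only [sub_zero] using volume_setOf_exists_reprSym_add_latticeVec_mem_le 0 hB
  -- the events
  set A : Fin (N + 1) → Fin (N + 1) → Set (Config (N + 1) (Fin 3) T3) := fun p m =>
    {w | ∃ k : Fin 3 → ℤ, Torus.reprSym ((w m).1 - (w p).1) + Torus.latticeVec k ∈ Sn ((w p).2 - (w m).2)}
    with hAdef
  set B : Fin (N + 1) → Fin (N + 1) → Set (Config (N + 1) (Fin 3) T3) := fun p j' =>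
    {w | ∃ k : Fin 3 → ℤ, Torus.reprSym ((w j').1 - (w p).1) + Torus.latticeVec k ∈
      S ((w j').2 - (w p).2) ∪ Sn ((w p).2 - (w j').2)} with hBdef
  -- measurability
  have hψm : ∀ (i j i' j'' : Fin (N + 1)) (k : Fin 3 → ℤ), Measurable fun w : Config (N + 1) (Fin 3) T3 =>
      (Torus.reprSym ((w i).1 - (w j).1) + Torus.latticeVec k, (w i').2 - (w j'').2) := by
    intro i j i' j'' k
    refine Measurable.prodMk ?_ ?_
    · exact (Torus.measurable_reprSym.comp
        ((measurable_pi_apply i).fst.sub (measurable_pi_apply j).fst)).add_const _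
    · exact (measurable_pi_apply i').snd.sub (measurable_pi_apply j'').snd
  have hAm : ∀ p m, MeasurableSet (A p m) := by
    intro p m
    have h1 : A p m = ⋃ k : Fin 3 → ℤ, (fun w : Config (N + 1) (Fin 3) T3 =>
        (Torus.reprSym ((w m).1 - (w p).1) + Torus.latticeVec k, (w p).2 - (w m).2)) ⁻¹'
          {q : V3 × V3 | q.1 ∈ Sn q.2} := by
      ext w; simp only [hAdef, Set.mem_setOf_eq, Set.mem_iUnion, Set.mem_preimage]
    rw [h1]
    exact MeasurableSet.iUnion fun k => hSnm.preimage (hψm m p p m k)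
  have hBm : ∀ p j', MeasurableSet (B p j') := by
    intro p j'
    have h2 : B p j' = ⋃ k : Fin 3 → ℤ, ((fun w : Config (N + 1) (Fin 3) T3 =>
          (Torus.reprSym ((w j').1 - (w p).1) + Torus.latticeVec k, (w j').2 - (w p).2)) ⁻¹'
            {q : V3 × V3 | q.1 ∈ S q.2} ∪
          (fun w : Config (N + 1) (Fin 3) T3 =>
            (Torus.reprSym ((w j').1 - (w p).1) + Torus.latticeVec k, (w p).2 - (w j').2)) ⁻¹'
            {q : V3 × V3 | q.1 ∈ Sn q.2}) := by
      ext w; simp only [hBdef, Set.mem_setOf_eq, Set.mem_iUnion, Set.mem_preimage, Set.mem_union]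
    rw [h2]
    exact MeasurableSet.iUnion fun k =>
      (hSm.preimage (hψm j' p j' p k)).union (hSnm.preimage (hψm j' p p j' k))
  -- the three-label statics
  set M₂ := ∫⁻ q, ENNReal.ofReal (‖q.2 - q.1‖ ^ 2) ∂((gaussMeasure u θ).prod (gaussMeasure u θ)) with hM₂
  have hM₂le : M₂ ≤ ENNReal.ofReal (4 * (‖u‖ ^ 2 + 3 * θ)) := EvenStressEnskog.lintegral_relSpeed_sq_le u hθ
  have hkey : ∀ p m j' : Fin (N + 1), p ≠ m → p ≠ j' → m ≠ j' →
      P (A p m ∩ B p j') ≤ ENNReal.ofReal (128 * (hsDiameter σ N) ^ 4 * Δ * (Δ + Δ)) * M₂ := by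
    intro p m j' hpm hpj hmj
    exact measure_windowEvent_inter_tubeEvent_le hσ2 ha hθ u Φ hpm hpj
      (fun T T' hT hT' => posGibbs_tripleEvent_le hsm hpm hpj hmj hT hT') hΔ.le hΔ.le hSnm hSm hSnvol hSvol hlift
  -- covering: would-be pairs put the configuration in the events
  have hcovA : ∀ w ∈ hardSphereDomain (Torus.geometry (Fin 3)) (N + 1) (hsDiameter σ N), ∀ p m : Fin (N + 1),
      (m, p) ∈ wouldBePairs (hsDiameter σ N) Δ w → w ∈ A p m := by
    intro w hw p m hmp
    obtain ⟨hne, hwb⟩ := (mem_wouldBePairs_iff (hsDiameter σ N) Δ w (m, p)).1 hmp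
    obtain ⟨k, hk⟩ := exists_latticeVec_mem_of_wouldBe hS hw hne hwb
    refine ⟨k, ?_⟩
    show Torus.reprSym ((w m).1 - (w p).1) + Torus.latticeVec k ∈ S (-((w p).2 - (w m).2))
    rw [neg_sub]
    exact hk
  have hcovB : ∀ w ∈ hardSphereDomain (Torus.geometry (Fin 3)) (N + 1) (hsDiameter σ N), ∀ p j' : Fin (N + 1),
      (j', p) ∈ wouldBePairs (hsDiameter σ N) Δ w → w ∈ B p j' := by
    intro w hw p j' hjp
    obtain ⟨hne, hwb⟩ := (mem_wouldBePairs_iff (hsDiameter σ N) Δ w (j', p)).1 hjp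
    obtain ⟨k, hk⟩ := exists_latticeVec_mem_of_wouldBe hS hw hne hwb
    exact ⟨k, Or.inl hk⟩
  -- the static majorant of the multi-pair count
  set Mst : Config (N + 1) (Fin 3) T3 → ℝ≥0∞ := fun w => ∑ i : Fin (N + 1), ∑ j : Fin (N + 1), ∑ k : Fin (N + 1),
    (if i ≠ j ∧ i ≠ k ∧ j ≠ k then (A i j ∩ B i k).indicator 1 w + (A j i ∩ B j k).indicator 1 w else 0)
    with hMst
  have hsummand : ∀ i j k : Fin (N + 1), Measurable fun w : Config (N + 1) (Fin 3) T3 =>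
      (if i ≠ j ∧ i ≠ k ∧ j ≠ k then (A i j ∩ B i k).indicator 1 w + (A j i ∩ B j k).indicator 1 w else 0
        : ℝ≥0∞) := by
    intro i j k
    by_cases hc : i ≠ j ∧ i ≠ k ∧ j ≠ k
    · simp only [if_pos hc]
      exact (measurable_one.indicator ((hAm i j).inter (hBm i k))).add
        (measurable_one.indicator ((hAm j i).inter (hBm j k)))
    · simp only [if_neg hc]
      exact measurable_const
  have hMstm : Measurable Mst := Finset.measurable_sum _ fun i _ =>
    Finset.measurable_sum _ fun j _ => Finset.measurable_sum _ fun k _ => hsummand i j k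
  have hdom : ∀ w ∈ hardSphereDomain (Torus.geometry (Fin 3)) (N + 1) (hsDiameter σ N),
      ((multiPairs (hsDiameter σ N) Δ w).card : ℝ≥0∞) ≤ Mst w := by
    intro w hw
    have h1 := card_multiPairs_le_sum (hsDiameter σ N) Δ w
    have h2 : ((multiPairs (hsDiameter σ N) Δ w).card : ℝ≥0∞) ≤ ((∑ i : Fin (N + 1), ∑ j : Fin (N + 1), ∑ k : Fin (N + 1),
        ((if i ≠ j ∧ i ≠ k ∧ j ≠ k ∧ (i, j) ∈ wouldBePairs (hsDiameter σ N) Δ w ∧ (i, k) ∈ wouldBePairs (hsDiameter σ N) Δ w then 1 else 0) +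
          (if i ≠ j ∧ i ≠ k ∧ j ≠ k ∧ (i, j) ∈ wouldBePairs (hsDiameter σ N) Δ w ∧ (j, k) ∈ wouldBePairs (hsDiameter σ N) Δ w then 1 else 0))
            : ℕ) : ℝ≥0∞) := by exact_mod_cast h1
    refine h2.trans ?_
    rw [Nat.cast_sum]
    refine Finset.sum_le_sum fun i _ => ?_
    rw [Nat.cast_sum]
    refine Finset.sum_le_sum fun j _ => ?_
    rw [Nat.cast_sum]
    refine Finset.sum_le_sum fun k _ => ?_
    by_cases hc : i ≠ j ∧ i ≠ k ∧ j ≠ k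
    · rw [if_pos hc, Nat.cast_add]
      gcongr
      · split_ifs with h
        · have hw' : w ∈ A i j ∩ B i k :=
            ⟨hcovA w hw i j ((mem_wouldBePairs_symm (hsDiameter σ N) Δ w i j).1 h.2.2.2.1),
              hcovB w hw i k ((mem_wouldBePairs_symm (hsDiameter σ N) Δ w i k).1 h.2.2.2.2)⟩
          rw [Set.indicator_of_mem hw', Pi.one_apply, Nat.cast_one]
        · simp
      · split_ifs with h
        · have hw' : w ∈ A j i ∩ B j k :=
            ⟨hcovA w hw j i h.2.2.2.1, hcovB w hw j k ((mem_wouldBePairs_symm (hsDiameter σ N) Δ w j k).1 h.2.2.2.2)⟩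
          rw [Set.indicator_of_mem hw', Pi.one_apply, Nat.cast_one]
        · simp
    · have h1' : ¬ (i ≠ j ∧ i ≠ k ∧ j ≠ k ∧ (i, j) ∈ wouldBePairs (hsDiameter σ N) Δ w ∧ (i, k) ∈ wouldBePairs (hsDiameter σ N) Δ w) :=
        fun h => hc ⟨h.1, h.2.1, h.2.2.1⟩
      have h2' : ¬ (i ≠ j ∧ i ≠ k ∧ j ≠ k ∧ (i, j) ∈ wouldBePairs (hsDiameter σ N) Δ w ∧ (j, k) ∈ wouldBePairs (hsDiameter σ N) Δ w) :=
        fun h => hc ⟨h.1, h.2.1, h.2.2.1⟩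
      rw [if_neg hc, if_neg h1', if_neg h2']
      simp
  -- the mean of the static majorant
  set c : ℝ := 128 * (hsDiameter σ N) ^ 4 * Δ * (Δ + Δ) * (4 * (‖u‖ ^ 2 + 3 * θ)) with hc
  have hc0 : 0 ≤ c := by positivity
  have hkey' : ∀ p m j' : Fin (N + 1), p ≠ m → p ≠ j' → m ≠ j' → P (A p m ∩ B p j') ≤ ENNReal.ofReal c := by
    intro p m j' hpm hpj hmj
    refine (hkey p m j' hpm hpj hmj).trans ?_
    rw [hc, ENNReal.ofReal_mul (by positivity : (0 : ℝ) ≤ 128 * (hsDiameter σ N) ^ 4 * Δ * (Δ + Δ))]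
    gcongr
  have hmeanSt : ∫⁻ w, Mst w ∂P ≤ ((N + 1 : ℕ) : ℝ≥0∞) ^ 3 * ENNReal.ofReal (2 * c) := by
    have hterm : ∀ i j k : Fin (N + 1), ∫⁻ w, (if i ≠ j ∧ i ≠ k ∧ j ≠ k then
        (A i j ∩ B i k).indicator 1 w + (A j i ∩ B j k).indicator 1 w else 0 : ℝ≥0∞) ∂P ≤
          ENNReal.ofReal (2 * c) := by
      intro i j k
      by_cases hcd : i ≠ j ∧ i ≠ k ∧ j ≠ k
      · simp only [if_pos hcd]
        rw [lintegral_add_left (measurable_one.indicator ((hAm i j).inter (hBm i k))),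
          lintegral_indicator_one ((hAm i j).inter (hBm i k)), lintegral_indicator_one ((hAm j i).inter (hBm j k)),
          two_mul, ENNReal.ofReal_add hc0 hc0]
        exact add_le_add (hkey' i j k hcd.1 hcd.2.1 hcd.2.2) (hkey' j i k (Ne.symm hcd.1) hcd.2.2 hcd.2.1)
      · simp only [if_neg hcd, lintegral_const, zero_mul, zero_le]
    calc ∫⁻ w, Mst w ∂P = ∑ i : Fin (N + 1), ∑ j : Fin (N + 1), ∑ k : Fin (N + 1), ∫⁻ w,
          (if i ≠ j ∧ i ≠ k ∧ j ≠ k then (A i j ∩ B i k).indicator 1 w + (A j i ∩ B j k).indicator 1 w else 0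
            : ℝ≥0∞) ∂P := by
          rw [hMst, lintegral_finsetSum _ fun i _ => Finset.measurable_sum _ fun j _ =>
            Finset.measurable_sum _ fun k _ => hsummand i j k]
          refine Finset.sum_congr rfl fun i _ => ?_
          rw [lintegral_finsetSum _ fun j _ => Finset.measurable_sum _ fun k _ => hsummand i j k]
          refine Finset.sum_congr rfl fun j _ => ?_
          exact lintegral_finsetSum _ fun k _ => hsummand i j k
      _ ≤ ∑ _i : Fin (N + 1), ∑ _j : Fin (N + 1), ∑ _k : Fin (N + 1), ENNReal.ofReal (2 * c) := by
          gcongr with i _ j _ k _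
          exact hterm i j k
      _ = ((N + 1 : ℕ) : ℝ≥0∞) ^ 3 * ENNReal.ofReal (2 * c) := by
          simp only [Finset.sum_const, Finset.card_univ, Fintype.card_fin, nsmul_eq_mul]
          ring
  -- the dynamical majorant: sum over the window starts, stationarity
  have hstat := measurePreserving_flow_localGibbsLaw_const σ a θ u N Φ
  set Mtot : Config (N + 1) (Fin 3) T3 → ℝ≥0∞ := fun z => ∑ k ∈ Finset.range K, Mst (Φ.flow (k * Δ) z)
    with hMtot
  have hMtotm : Measurable Mtot := Finset.measurable_sum _ fun k _ => hMstm.comp (Φ.measurable_flow _)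
  have hmeanTot : ∫⁻ z, Mtot z ∂P = (K : ℝ≥0∞) * ∫⁻ w, Mst w ∂P := by
    calc ∫⁻ z, Mtot z ∂P = ∑ k ∈ Finset.range K, ∫⁻ z, Mst (Φ.flow (k * Δ) z) ∂P :=
          lintegral_finsetSum _ fun k _ => hMstm.comp (Φ.measurable_flow _)
      _ = ∑ _k ∈ Finset.range K, ∫⁻ w, Mst w ∂P :=
          Finset.sum_congr rfl fun k _ => (hstat _).lintegral_comp hMstm
      _ = (K : ℝ≥0∞) * ∫⁻ w, Mst w ∂P := by
          rw [Finset.sum_const, Finset.card_range, nsmul_eq_mul]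
  -- the event is dominated by the majorant on the good set
  have hsub : {z | z ∈ Φ.good ∧ y ≤ ∑ k ∈ Finset.range K, ((multiPairs (hsDiameter σ N) Δ (Φ.flow (k * Δ) z)).card : ℝ)} ⊆
      {z | ENNReal.ofReal y ≤ Mtot z} := by
    rintro z ⟨hz, hle⟩
    have hcast : ENNReal.ofReal (∑ k ∈ Finset.range K, ((multiPairs (hsDiameter σ N) Δ (Φ.flow (k * Δ) z)).card : ℝ)) =
        ∑ k ∈ Finset.range K, ((multiPairs (hsDiameter σ N) Δ (Φ.flow (k * Δ) z)).card : ℝ≥0∞) := by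
      rw [ENNReal.ofReal_sum_of_nonneg fun k _ => Nat.cast_nonneg _]
      exact Finset.sum_congr rfl fun k _ => ENNReal.ofReal_natCast _
    refine (ENNReal.ofReal_le_ofReal hle).trans ?_
    rw [hcast]
    refine Finset.sum_le_sum fun k _ => hdom _ ?_
    exact Φ.good_subset (Φ.mapsTo_good _ hz)
  -- Markov
  have hy0 : ENNReal.ofReal y ≠ 0 := (ENNReal.ofReal_pos.2 hy).ne'
  have s1 : P {z | z ∈ Φ.good ∧ y ≤ ∑ k ∈ Finset.range K, ((multiPairs (hsDiameter σ N) Δ (Φ.flow (k * Δ) z)).card : ℝ)}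
      ≤ P {z | ENNReal.ofReal y ≤ Mtot z} := measure_mono hsub
  have s2 : P {z | ENNReal.ofReal y ≤ Mtot z} ≤ (∫⁻ z, Mtot z ∂P) / ENNReal.ofReal y :=
    meas_ge_le_lintegral_div hMtotm.aemeasurable hy0 ENNReal.ofReal_ne_top
  have s3 : (∫⁻ z, Mtot z ∂P) / ENNReal.ofReal y ≤
      (K : ℝ≥0∞) * (((N + 1 : ℕ) : ℝ≥0∞) ^ 3 * ENNReal.ofReal (2 * c)) / ENNReal.ofReal y := by
    rw [hmeanTot]
    gcongr
  have s4 : (K : ℝ≥0∞) * (((N + 1 : ℕ) : ℝ≥0∞) ^ 3 * ENNReal.ofReal (2 * c)) / ENNReal.ofReal y =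
      ENNReal.ofReal ((K : ℝ) * ((N + 1 : ℕ) : ℝ) ^ 3 *
          (2048 * (hsDiameter σ N) ^ 4 * Δ ^ 2 * (‖u‖ ^ 2 + 3 * θ)) / y) := by
    rw [ENNReal.ofReal_div_of_pos hy]
    congr 1
    have h1 : (K : ℝ≥0∞) = ENNReal.ofReal (K : ℝ) := (ENNReal.ofReal_natCast K).symm
    have h2 : ((N + 1 : ℕ) : ℝ≥0∞) = ENNReal.ofReal ((N + 1 : ℕ) : ℝ) := (ENNReal.ofReal_natCast _).symm
    rw [h1, h2, ← ENNReal.ofReal_pow (Nat.cast_nonneg _), ← ENNReal.ofReal_mul (by positivity),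
      ← ENNReal.ofReal_mul (by positivity)]
    congr 1
    rw [hc]
    ring
  exact s1.trans (s2.trans (s3.trans s4.le))

/-! ### The two halves together: a finite-`N` bound at rung 0 -/

/-- **Finite-`N` rung-0 bound.**  For constant profiles, small density, `N ≥ 1`, a flow `Φ`, a window `Δ > 0`,
`τ, η > 0`, and GIVEN the rung-0 short-flight tail at `(σ, N, Φ)` (the landed
`EvenStressEnskog.shortFlightCountRung0_le`, passed as `hshort`), the Gibbs probability of the burst event
`{η < ε/(N+1) · lineBursts ε Δ τ}` is at most the sum of the static bound
(`measure_sum_card_multiPairs_ge_le`) and the short-flight bound, both at level `y = η(N+1)/(2ε)`: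
the event splits into `{Σ #multiPairs ≥ y} ∪ {Σ secondaryCount ≥ y}` on the good set (which is conull),
and `Σ secondaryCount ≤` short-flight count (`sum_secondaryCount_le_shortCount`). [folklore] -/
theorem measure_bursts_rung0_le {σ : ℝ} (hσ : 0 < σ) (hσ2 : σ ≤ 1 / 2) (hsm : SmallDensity uniformProfile σ)
    {a θ : ℝ} (ha : 0 < a) (hθ : 0 < θ) (u : V3) {N : ℕ}
    (Φ : HardSphereFlow (Torus.geometry (Fin 3)) (hsDiameter σ N) (N + 1))
    {Δ τ η : ℝ} (hΔ : 0 < Δ) (hτ : 0 < τ) (hη : 0 < η) {Bsh : ℝ} (hBsh : 0 ≤ Bsh)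
    (hshort : localGibbsLaw σ (fun _ => a) (fun _ => u) (fun _ => θ) N Φ
        {z | z ∈ Φ.good ∧ η * (N + 1 : ℝ) / (2 * hsDiameter σ N) ≤
          collisionPairSum (Torus.geometry (Fin 3)) (hsDiameter σ N) (orbit σ N Φ z) (Set.Icc 0 τ)
            (fun s i j => if s - Δ < pairFlightStart σ N Φ z i j s then (1 : ℝ) else 0)} ≤ ENNReal.ofReal Bsh) :
    localGibbsLaw σ (fun _ => a) (fun _ => u) (fun _ => θ) N Φ
        {z | η < hsDiameter σ N / (N + 1 : ℝ) * lineBursts (hsDiameter σ N) Δ τ (fun s => Φ.flow s z)} ≤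
      ENNReal.ofReal ((⌊τ / Δ⌋₊ : ℝ) * ((N + 1 : ℕ) : ℝ) ^ 3 *
          (2048 * hsDiameter σ N ^ 4 * Δ ^ 2 * (‖u‖ ^ 2 + 3 * θ)) / (η * (N + 1 : ℝ) / (2 * hsDiameter σ N)) + Bsh) := by
  have hε0 : 0 < hsDiameter σ N := hsDiameter_pos hσ N
  have hn : (0 : ℝ) < (N + 1 : ℝ) := by positivity
  set y : ℝ := η * (N + 1 : ℝ) / (2 * hsDiameter σ N) with hydef
  have hy : 0 < y := by positivity
  set P := localGibbsLaw σ (fun _ => a) (fun _ => u) (fun _ => θ) N Φ with hPdef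
  -- the decomposition of the event
  have hsplit : {z | η < hsDiameter σ N / (N + 1 : ℝ) * lineBursts (hsDiameter σ N) Δ τ (fun s => Φ.flow s z)} ⊆
      Φ.goodᶜ ∪ ({z | z ∈ Φ.good ∧ y ≤ ∑ k ∈ Finset.range ⌊τ / Δ⌋₊,
          ((multiPairs (hsDiameter σ N) Δ (Φ.flow (k * Δ) z)).card : ℝ)} ∪
        {z | z ∈ Φ.good ∧ y ≤ collisionPairSum (Torus.geometry (Fin 3)) (hsDiameter σ N) (orbit σ N Φ z)
          (Set.Icc 0 τ) (fun s i j => if s - Δ < pairFlightStart σ N Φ z i j s then (1 : ℝ) else 0)}) := by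
    intro z hz
    by_cases hgood : z ∈ Φ.good
    · right
      simp only [Set.mem_setOf_eq] at hz
      rw [lineBursts, Finset.sum_add_distrib] at hz
      -- `η < ε/(N+1) (S₁ + S₂)` gives `S₁ + S₂ > 2y`
      have h2y : 2 * y < (∑ k ∈ Finset.range ⌊τ / Δ⌋₊,
            ((multiPairs (hsDiameter σ N) Δ (Φ.flow (k * Δ) z)).card : ℝ)) +
          ∑ k ∈ Finset.range ⌊τ / Δ⌋₊,
            (secondaryCount (hsDiameter σ N) (fun s => Φ.flow s z) (k * Δ) (k * Δ + Δ) : ℝ) := by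
        rw [hydef, lt_iff_not_ge]
        intro hle
        have := mul_le_mul_of_nonneg_left hle (div_pos hε0 hn).le
        have h' : hsDiameter σ N / (N + 1 : ℝ) * (2 * (η * (N + 1 : ℝ) / (2 * hsDiameter σ N))) = η := by
          field_simp
        linarith
      by_cases hst : y ≤ ∑ k ∈ Finset.range ⌊τ / Δ⌋₊, ((multiPairs (hsDiameter σ N) Δ (Φ.flow (k * Δ) z)).card : ℝ)
      · exact Or.inl ⟨hgood, hst⟩
      · right
        refine ⟨hgood, ?_⟩
        push Not at hst
        have hsec : y ≤ ∑ k ∈ Finset.range ⌊τ / Δ⌋₊,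
            (secondaryCount (hsDiameter σ N) (fun s => Φ.flow s z) (k * Δ) (k * Δ + Δ) : ℝ) := by linarith
        exact hsec.trans (sum_secondaryCount_le_shortCount Φ hgood hΔ hτ.le)
    · exact Or.inl hgood
  -- the bad set is null
  have hbad : P Φ.goodᶜ = 0 := by
    rw [hPdef, localGibbsLaw_eq]
    exact localGibbsMeasure_absolutelyContinuous σ _ _ _ N Φ Φ.measure_compl_good
  have hstat := measure_sum_card_multiPairs_ge_le hσ hσ2 hsm ha hθ u Φ hΔ ⌊τ / Δ⌋₊ hy
  have hnonneg : 0 ≤ (⌊τ / Δ⌋₊ : ℝ) * ((N + 1 : ℕ) : ℝ) ^ 3 *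
      (2048 * hsDiameter σ N ^ 4 * Δ ^ 2 * (‖u‖ ^ 2 + 3 * θ)) / y := by positivity
  calc P {z | η < hsDiameter σ N / (N + 1 : ℝ) * lineBursts (hsDiameter σ N) Δ τ (fun s => Φ.flow s z)}
      ≤ P (Φ.goodᶜ ∪ ({z | z ∈ Φ.good ∧ y ≤ ∑ k ∈ Finset.range ⌊τ / Δ⌋₊,
          ((multiPairs (hsDiameter σ N) Δ (Φ.flow (k * Δ) z)).card : ℝ)} ∪
        {z | z ∈ Φ.good ∧ y ≤ collisionPairSum (Torus.geometry (Fin 3)) (hsDiameter σ N) (orbit σ N Φ z)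
          (Set.Icc 0 τ) (fun s i j => if s - Δ < pairFlightStart σ N Φ z i j s then (1 : ℝ) else 0)})) :=
        measure_mono hsplit
    _ ≤ P Φ.goodᶜ + (P {z | z ∈ Φ.good ∧ y ≤ ∑ k ∈ Finset.range ⌊τ / Δ⌋₊,
          ((multiPairs (hsDiameter σ N) Δ (Φ.flow (k * Δ) z)).card : ℝ)} +
        P {z | z ∈ Φ.good ∧ y ≤ collisionPairSum (Torus.geometry (Fin 3)) (hsDiameter σ N) (orbit σ N Φ z)
          (Set.Icc 0 τ) (fun s i j => if s - Δ < pairFlightStart σ N Φ z i j s then (1 : ℝ) else 0)}) :=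
        (measure_union_le _ _).trans (add_le_add le_rfl (measure_union_le _ _))
    _ ≤ 0 + (ENNReal.ofReal ((⌊τ / Δ⌋₊ : ℝ) * ((N + 1 : ℕ) : ℝ) ^ 3 *
          (2048 * hsDiameter σ N ^ 4 * Δ ^ 2 * (‖u‖ ^ 2 + 3 * θ)) / y) + ENNReal.ofReal Bsh) := by
        rw [hbad]
        exact add_le_add le_rfl (add_le_add hstat hshort)
    _ = ENNReal.ofReal ((⌊τ / Δ⌋₊ : ℝ) * ((N + 1 : ℕ) : ℝ) ^ 3 *
          (2048 * hsDiameter σ N ^ 4 * Δ ^ 2 * (‖u‖ ^ 2 + 3 * θ)) / y + Bsh) := by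
        rw [zero_add, ENNReal.ofReal_add hnonneg hBsh]


/-! ### Registered helper stub -/

/-- **Helper stub `stub_burstsRung0Bound`** (registered on stmt-AtomisticToContinuum-13080 for this file): `∀`-form of
`measure_bursts_rung0_le`. [folklore] -/
theorem stub_burstsRung0Bound :
    ∀ (σ : ℝ), 0 < σ → σ ≤ 1 / 2 → SmallDensity uniformProfile σ → ∀ (a θ : ℝ), 0 < a → 0 < θ → ∀ (u : V3) (N : ℕ) (Φ : HardSphereFlow (Torus.geometry (Fin 3)) (hsDiameter σ N) (N + 1)) (Δ τ η : ℝ), 0 < Δ → 0 < τ → 0 < η → ∀ (Bsh : ℝ), 0 ≤ Bsh → localGibbsLaw σ (fun _ => a) (fun _ => u) (fun _ => θ) N Φ {z | z ∈ Φ.good ∧ η * (N + 1 : ℝ) / (2 * hsDiameter σ N) ≤ collisionPairSum (Torus.geometry (Fin 3)) (hsDiameter σ N) (orbit σ N Φ z) (Set.Icc 0 τ) (fun s i j => if s - Δ < pairFlightStart σ N Φ z i j s then (1 : ℝ) else 0)} ≤ ENNReal.ofReal Bsh → localGibbsLaw σ (fun _ => a) (fun _ => u) (fun _ => θ) N Φ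 {z | η < hsDiameter σ N / (N + 1 : ℝ) * lineBursts (hsDiameter σ N) Δ τ (fun s => Φ.flow s z)} ≤ ENNReal.ofReal ((⌊τ / Δ⌋₊ : ℝ) * ((N + 1 : ℕ) : ℝ) ^ 3 * (2048 * hsDiameter σ N ^ 4 * Δ ^ 2 * (‖u‖ ^ 2 + 3 * θ)) / (η * (N + 1 : ℝ) / (2 * hsDiameter σ N)) + Bsh) :=
  fun _ hσ hσ2 hsm _ _ ha hθ u _ Φ _ _ _ hΔ hτ hη _ hBsh hshort =>
    measure_bursts_rung0_le hσ hσ2 hsm ha hθ u Φ hΔ hτ hη hBsh hshort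

end RateFloorNoBursts

end Summit.AtomisticToContinuum.HydrodynamicLimit.Theorems

end
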